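import Mathlib.Analysis.InnerProductSpace.PiL2
import HarnessLib

/-!
# Route ReggeStarCoercivity — crux `StarCoercivity`, line `separation-padding-transfer`:
stub `stub_shellSuccAbove` (supports item `stmt-AtomisticToContinuum-13600`)

Bookkeeping fact for the closest-pair deletion step of the line: when a particle `i₀` of a finite
configuration `x : Fin (N + 1) → ℝ³` is deleted (the remaining configuration is `x ∘ i₀.succAbove`
on `Fin N`), the recentred, `a⁻¹`-rescaled `6/5`-shell of a site `i₀.succAbove j` lying farther than
`6/5` from `x i₀` is the same finset whether it is read in `x` or in `x ∘ i₀.succAbove`.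

Proof: finset extensionality. A site `k` in the shell read in `x` satisfies
`dist (x (i₀.succAbove j)) (x k) ≤ 6/5 < dist (x (i₀.succAbove j)) (x i₀)`, so `k ≠ i₀` and
`k = i₀.succAbove k'` (`Fin.exists_succAbove_eq`); the two membership conditions then transfer along
the injection `i₀.succAbove` (`Fin.succAbove_right_injective`). Mathlib only; no named facts.
-/

noncomputable section

open scoped Classical

namespace Summit.AtomisticToContinuum.Crystallization.Theorems.SeparationPaddingTransfer

/-- **Far shells survive the deletion of a particle.** For a configuration
`x : Fin (N + 1) → ℝ³`, a deleted index `i₀`, a remaining site `j : Fin N` with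
`6/5 < dist (x (i₀.succAbove j)) (x i₀)` and any scale `a`, the recentred rescaled `6/5`-shell
`{a⁻¹ • (x k - x (i₀.succAbove j)) | k ≠ i₀.succAbove j, dist (x (i₀.succAbove j)) (x k) ≤ 6/5}` of the
site computed in `x` equals the same shell computed in the deleted configuration `x ∘ i₀.succAbove`
(indices `k : Fin N`, `k ≠ j`). The particle `i₀` itself is excluded from the first shell by the
distance hypothesis, and every other index is in the range of `i₀.succAbove`. -/
theorem stub_shellSuccAbove : ∀ (N : ℕ) (x : Fin (N + 1) → EuclideanSpace ℝ (Fin 3)) (i₀ : Fin (N + 1)) (j : Fin N) (a : ℝ), 6 / 5 < dist (x (Fin.succAbove i₀ j)) (x i₀) → ((Finset.univ.filter fun k : Fin (N + 1) => k ≠ Fin.succAbove i₀ j ∧ dist (x (Fin.succAbove i₀ j)) (x k) ≤ 6 / 5).image fun k => a⁻¹ • (x k - x (Fin.succAbove i₀ j))) = ((Finset.univ.filter fun k : Fin N => k ≠ j ∧ dist (x (Fin.succAbove i₀ j)) (x (Fin.succAbove i₀ k)) ≤ 6 / 5).image fun k => a⁻¹ • (x (Fin.succAbove i₀ k) - x (Fin.succAbove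 i₀ j))) := by
  intro N x i₀ j a hfar
  ext v
  simp only [Finset.mem_image, Finset.mem_filter, Finset.mem_univ, true_and]
  constructor
  · rintro ⟨k, ⟨hk1, hk2⟩, rfl⟩
    have hki : k ≠ i₀ := by
      rintro rfl
      exact absurd hk2 (not_le.mpr hfar)
    obtain ⟨k', rfl⟩ := Fin.exists_succAbove_eq hki
    exact ⟨k', ⟨ne_of_apply_ne (Fin.succAbove i₀) hk1, hk2⟩, rfl⟩
  · rintro ⟨k', ⟨hk1, hk2⟩, rfl⟩
    exact ⟨Fin.succAbove i₀ k', ⟨Fin.succAbove_right_injective.ne hk1, hk2⟩, rfl⟩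

end Summit.AtomisticToContinuum.Crystallization.Theorems.SeparationPaddingTransfer

end
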